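import Mathlib

/-!
# Integer adjugate bounds (stub L4 of the `IntDetQP` birth line)

Route `route-ValiantsHypothesis-IntegralOrbits`, supports item `stmt-ValiantsHypothesis-7677`.

**Statement.** For an integer matrix `A : Matrix n n ℤ` with `|A i j| ≤ K` and `1 ≤ K`,
`|det A| ≤ (card n)! · K ^ card n` and every adjugate entry satisfies the same bound.

**Proof.** `Matrix.det_le` with the absolute value `AbsoluteValue.abs` on `ℤ` gives the
determinant bound.  For the adjugate, `adjugate A i j = det (A.updateRow j (Pi.single i 1))`
(`Matrix.adjugate_apply`); every entry of the updated matrix is either an entry of `A` or a value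
of `Pi.single i 1`, i.e. `0` or `1`, hence bounded by `K` since `1 ≤ K`, and `Matrix.det_le`
applies again.
-/

set_option linter.dupNamespace false -- single-conjunct summit

namespace Summit.ValiantsHypothesis.ValiantsHypothesis.Theorems

namespace IntegralOrbitsIntDetQPAdjugateEntryBound

/-- The crude Leibniz bound `|det A| ≤ (card n)! · K ^ card n` for an integer matrix whose entries
are bounded by `K` in absolute value. [folklore] -/
theorem abs_det_le {n : Type} [Fintype n] [DecidableEq n] (A : Matrix n n ℤ) (K : ℤ)
    (hA : ∀ i j, |A i j| ≤ K) :
    |A.det| ≤ (Nat.factorial (Fintype.card n) : ℤ) * K ^ Fintype.card n := by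
  have h := Matrix.det_le (A := A) (abv := AbsoluteValue.abs) (x := K)
    (fun i j => by simpa only [AbsoluteValue.abs_apply] using hA i j)
  simpa only [AbsoluteValue.abs_apply, nsmul_eq_mul] using h

end IntegralOrbitsIntDetQPAdjugateEntryBound

open IntegralOrbitsIntDetQPAdjugateEntryBound in
/-- **Stub L4 (integer adjugate bounds)**: Hadamard-free crude bounds `|det A| ≤ n!·K^n` and
`|adj A i j| ≤ n!·K^n` for an integer matrix with entries bounded by `K ≥ 1`. [folklore] -/
theorem stub_adjugateEntryBound :
    ∀ (n : Type) [Fintype n] [DecidableEq n] (A : Matrix n n ℤ) (K : ℕ),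
      1 ≤ K → (∀ i j, |A i j| ≤ K) →
      |A.det| ≤ Nat.factorial (Fintype.card n) * K ^ Fintype.card n ∧
      ∀ i j, |A.adjugate i j| ≤ Nat.factorial (Fintype.card n) * K ^ Fintype.card n := by
  intro n _ _ A K hK hA
  refine ⟨abs_det_le A K hA, fun i j => ?_⟩
  rw [Matrix.adjugate_apply]
  refine abs_det_le _ K fun i' j' => ?_
  rw [Matrix.updateRow_apply]
  split_ifs with h
  · rw [Pi.single_apply]
    split_ifs
    · rw [abs_one]
      exact_mod_cast hK
    · rw [abs_zero]
      exact_mod_cast Nat.zero_le K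
  · exact hA i' j'

end Summit.ValiantsHypothesis.ValiantsHypothesis.Theorems
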